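import Summits.Ventures.PercRepro.C041ZonePortCSCaseII
import Summits.Ventures.PercRepro.C041ZonePortCSCaseIV
import Summits.Ventures.PercRepro.C041ZonePortCSUnport

/-!
# THEOREM R-CS (mine-3's C-041.md §17 (a)): CONJECTURE (CS) HOLDS ON EVERY ZONE PORT PROBLEM (p6, gen 28)

Setting of `C041ZonePortCSDefs` and the case modules.  THE GATE INDUCTION, run once for any predicate `Q` of port
problems (`cs_induction`, strong induction on the number of zones): no zone; a non-switchable gate; a gate carrying
both terminal types; pure-type gates of both types; ALL gates switchable of pure type `{1}` — then `Q` for the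
problem with the gates made ordinary (`unport`, fewer zones, zones still reached) gives `Q`; all of pure type `{2}`
likewise.  The case split is exhaustive by `gate_cases`.  For `Q = CSOr` the cases are `csOr_of_Z_empty`,
`csOr_of_forced_gate`, `csOr_of_twoType_gate`, `csOr_of_pure_gates_mixed`, `csOr_of_pure₁_gates`, and the pure-`{2}`
case is the pure-`{1}` case of the terminal swap (`swap_unport`, `csOr_swap`).

* **`csOr_of_zonesReached`** — THEOREM R-CS: on every zone port problem whose zones are reached from the root set,
  `(#valid − #Good₁ − #Good₂)₊² ≤ #Good₁ · #Good₂`;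
* `phiOr_nonneg_of_cs` — THEOREM R's LEMMA `0 ≤ Φ∨ P` as the AM–GM corollary (a second proof of `phiOr_nonneg`).
-/

namespace PercRepro

namespace ZonePort

namespace Problem

open Finset CSCount

variable {V E : Type*}

section Induction

variable [DecidableEq V]

/-- The swap commutes with making zones ordinary. -/
theorem swap_unport (P : Problem V E) (S : Finset (Finset V)) : P.swap.unport S = (P.unport S).swap := rfl

/-- **The gate induction, once for any predicate `Q`**, given the case lemmas: `Q` without zones, with a
non-switchable gate, with a two-type gate, with pure-type gates of both types, and — when every gate is switchable
and of one pure type — from `Q` of the problem with the gates made ordinary. -/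
theorem cs_induction (Q : Problem V E → Prop)
    (hempty : ∀ P : Problem V E, P.Z = ∅ → Q P)
    (hforced : ∀ (P : Problem V E) (C : Finset V), P.IsGate C → P.sw C = false → Q P)
    (htwo : ∀ (P : Problem V E) (C : Finset V), P.IsGate C → ∀ e₁ e₂ : P.Term, P.tz e₁.1 = C → P.tz e₂.1 = C →
      P.ts e₁.1 = false → P.ts e₂.1 = true → Q P)
    (hmixed : ∀ (P : Problem V E) (e f : P.Term), P.IsGate (P.tz e.1) → P.IsGate (P.tz f.1) → P.ts e.1 = false →
      P.ts f.1 = true → P.Pure₁ (P.tz e.1) → P.Pure₂ (P.tz f.1) → Q P)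
    (hpure₁ : ∀ (P : Problem V E) (S : Finset (Finset V)), (∀ C, C ∈ S ↔ P.IsGate C) →
      (∀ C ∈ S, P.sw C = true ∧ P.Pure₁ C) → (∃ e : P.Term, P.tz e.1 ∈ S) → Q (P.unport S) → Q P)
    (hpure₂ : ∀ (P : Problem V E) (S : Finset (Finset V)), (∀ C, C ∈ S ↔ P.IsGate C) →
      (∀ C ∈ S, P.sw C = true ∧ P.Pure₂ C) → (∃ e : P.Term, P.tz e.1 ∈ S) → Q (P.unport S) → Q P) :
    ∀ (n : ℕ) (P : Problem V E), P.Z.card = n → P.ZonesReached → Q P := by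
  intro n
  induction n using Nat.strong_induction_on with
  | _ n ih =>
  intro P hn hconn
  classical
  by_cases hZ : P.Z = ∅
  · exact hempty P hZ
  obtain ⟨C₀, hC₀⟩ := gates_nonempty hconn (Finset.nonempty_iff_ne_empty.2 hZ)
  by_cases hF : ∃ C, P.IsGate C ∧ P.sw C = false
  · obtain ⟨C, hC, hsw⟩ := hF
    exact hforced P C hC hsw
  by_cases hT : ∃ C, P.IsGate C ∧ ∃ e₁ e₂ : P.Term, P.tz e₁.1 = C ∧ P.tz e₂.1 = C ∧ P.ts e₁.1 = false ∧
      P.ts e₂.1 = true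
  · obtain ⟨C, hC, e₁, e₂, h1, h2, h3, h4⟩ := hT
    exact htwo P C hC e₁ e₂ h1 h2 h3 h4
  -- every gate is switchable and of a pure type, with an edge
  have hgate : ∀ C, P.IsGate C → P.sw C = true ∧
      ((∃ e : P.Term, P.tz e.1 = C ∧ P.ts e.1 = false ∧ P.Pure₁ C) ∨
        (∃ e : P.Term, P.tz e.1 = C ∧ P.ts e.1 = true ∧ P.Pure₂ C)) := by
    intro C hC
    rcases gate_cases hC with hsw | ⟨hsw, htwo' | h | h⟩
    · exact absurd ⟨C, hC, hsw⟩ hF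
    · obtain ⟨e₁, e₂, h1, h2, h3, h4⟩ := htwo'
      exact absurd ⟨C, hC, e₁, e₂, h1, h2, h3, h4⟩ hT
    · exact ⟨hsw, Or.inl h⟩
    · exact ⟨hsw, Or.inr h⟩
  -- the gates, and the induction hypothesis for the problem with the gates made ordinary
  set S := P.Z.filter (fun C => P.IsGate C) with hS
  have hmemS : ∀ C, C ∈ S ↔ P.IsGate C := fun C => by
    rw [hS, Finset.mem_filter]
    exact ⟨fun h => h.2, fun h => ⟨h.mem, h⟩⟩
  have hIH : Q (P.unport S) := by
    refine ih _ ?_ _ rfl (zonesReached_unport hconn)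
    rw [← hn]
    exact card_unport_Z_lt hC₀.mem ((hmemS C₀).2 hC₀)
  have hedge : ∃ e : P.Term, P.tz e.1 ∈ S := by
    rcases (hgate C₀ hC₀).2 with ⟨e, heC, _, _⟩ | ⟨e, heC, _, _⟩
    · exact ⟨e, heC ▸ (hmemS C₀).2 hC₀⟩
    · exact ⟨e, heC ▸ (hmemS C₀).2 hC₀⟩
  by_cases h1 : ∃ e : P.Term, P.IsGate (P.tz e.1) ∧ P.ts e.1 = false ∧ P.Pure₁ (P.tz e.1)
  · by_cases h2 : ∃ f : P.Term, P.IsGate (P.tz f.1) ∧ P.ts f.1 = true ∧ P.Pure₂ (P.tz f.1)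
    · obtain ⟨e, hCe, he, hpe⟩ := h1
      obtain ⟨f, hCf, hf, hpf⟩ := h2
      exact hmixed P e f hCe hCf he hf hpe hpf
    · -- every gate is of pure type `{1}`
      refine hpure₁ P S hmemS (fun C hC => ?_) hedge hIH
      have hC := (hmemS C).1 hC
      obtain ⟨hsw, ⟨_, _, _, hp⟩ | ⟨f, hfC, hfs, hp⟩⟩ := hgate C hC
      · exact ⟨hsw, hp⟩
      · exact absurd ⟨f, hfC ▸ hC, hfs, hfC ▸ hp⟩ h2
  · -- every gate is of pure type `{2}`
    refine hpure₂ P S hmemS (fun C hC => ?_) hedge hIH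
    have hC := (hmemS C).1 hC
    obtain ⟨hsw, ⟨e, heC, hes, hp⟩ | ⟨_, _, _, hp⟩⟩ := hgate C hC
    · exact absurd ⟨e, heC ▸ hC, hes, heC ▸ hp⟩ h1
    · exact ⟨hsw, hp⟩

end Induction

section TheoremRCS

variable [Fintype E] [DecidableEq E] [DecidableEq V]

/-- **THEOREM R-CS (mine-3, C-041.md §17 (a))**: on every zone port problem whose zones are reached from the root
set, CONJECTURE (CS) holds — `(#valid − #Good₁ − #Good₂)₊² ≤ #Good₁ · #Good₂`. -/
theorem csOr_of_zonesReached (P : Problem V E) (hconn : P.ZonesReached) : P.CSOr :=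
  cs_induction CSOr (fun _ h => csOr_of_Z_empty h)
    (fun _ _ hC hsw => csOr_of_forced_gate hC hsw)
    (fun _ _ hC _ _ h1 h2 h3 h4 => csOr_of_twoType_gate hC h1 h2 h3 h4)
    (fun _ _ _ hCe hCf he hf hpe hpf => csOr_of_pure_gates_mixed hCe hCf he hf hpe hpf)
    (fun _ _ hmem hS hedge h => by
      obtain ⟨e, he⟩ := hedge
      exact csOr_of_pure₁_gates (fun C hC => (hmem C).1 hC) (fun C hC => (hS C hC).2) (fun C hC => (hS C hC).1) he h)
    (fun P S hmem hS hedge h => by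
      obtain ⟨e, he⟩ := hedge
      rw [← csOr_swap]
      have h' : (P.swap.unport S).CSOr := by
        rw [swap_unport]
        exact csOr_swap.2 h
      exact csOr_of_pure₁_gates (P := P.swap) (fun C hC => (isGate_swap C).2 ((hmem C).1 hC))
        (fun C hC => (pure₁_swap C).2 (hS C hC).2) (fun C hC => (hS C hC).1) (e := P.swapTerm e) he h')
    _ P rfl hconn

/-- **THEOREM R's LEMMA as the AM–GM corollary of THEOREM R-CS**: `0 ≤ Φ∨ P` (a second proof of `phiOr_nonneg`). -/
theorem phiOr_nonneg_of_cs (P : Problem V E) (hconn : P.ZonesReached) : 0 ≤ P.phiOr :=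
  phiOr_nonneg_of_csOr (csOr_of_zonesReached P hconn)

end TheoremRCS

end Problem

end ZonePort

end PercRepro
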